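import Mathlib.LinearAlgebra.Basis.VectorSpace
import Literature.AlgebraicTopology.SingularHomology.SingularChainsConcrete
import Literature.AlgebraicTopology.SingularHomology.UniversalCoefficientsField
import HarnessLib

/-!
# Vanishing of singular homology ascends along field extensions (`Hₙ(X; K) = 0 ⇒ Hₙ(X; L) = 0`)

Let `L ⊇ K` be a field extension (`[Algebra K L]`) and `X` a topological space. The singular
chain complex with coefficients in `L` is the base change of the one with coefficients in `K`,
`Cₙ(X; L) = Cₙ(X; K) ⊗_K L`, and `- ⊗_K L` is exact, so `Hₙ(X; L) ≅ Hₙ(X; K) ⊗_K L`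
(A. Hatcher, *Algebraic Topology* (2002), §3.A, Lemma 3A.1/Cor. 3A.4 with `Tor_K = 0` over a
field: "`Hₙ(X; G) ≈ Hₙ(X; ℤ) ⊗ G ⊕ Tor(Hₙ₋₁(X; ℤ), G)`", and over a field coefficient ring the
`Tor` term vanishes). This file PROVES the consequence that is needed to compare Betti numbers
over different fields of the same characteristic without developing `Tor`:

* `isZero_singularHomology_of_isZero_of_algebra`: `Hₙ(X; K) = 0 → Hₙ(X; L) = 0`;
* `nontrivial_singularHomology_of_algebra`: contrapositive, a non-zero class over `L` forces a
  non-zero class over `K`;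
* `one_le_bettiNumber_of_ne_zero_of_algebra`: if `Hₙ(X; K)` is finite-dimensional and some class
  in `Hⁿ(X; L)` is non-zero then `1 ≤ bₙ(X; K)` (with the tree's universal coefficient theorem
  over the field `L`, `kroneckerPairing_injective_of_field`). This is the form consumed by
  `Literature/AlgebraicGeometry/Motives/KaehlerTopologyProofs.lean` (hard Lefschetz is a statement
  about `H*(M; ℝ)`, Betti numbers are `bₖ(M; ℚ)`).

The proof is the coordinate argument on the tree's concrete chains
`CChain L X n = (SingularSimplex X n →₀ L)` (`…SingularChainsConcrete`): pick a `K`-basis `b` of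
`L`; an `L`-chain `w` is `∑ᵢ bᵢ • (wᵢ ⊗ 1)` for its finitely many non-zero coordinate chains
`wᵢ = (b.coord i)_* w ∈ Cₙ(X; K)` (`CChain.sum_smul_mapRange_coord_eq`); the boundary has integer
coefficients, so it commutes with every `K`-linear change of coefficients
(`csingularChainComplex.mapRange_bd`) and the `L`-boundary restricts to the `K`-boundary
(`csingularChainComplex.bd_eq_bd_of_algebra`); hence the `wᵢ` of a cycle are cycles, and if they
all bound, `wᵢ = ∂yᵢ`, then `w = ∂(∑ᵢ bᵢ • (yᵢ ⊗ 1))` (`CChain.exists_bd_eq_of_forall_coord`).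
The passage between Mathlib's singular chain complex and the concrete one is the tree's
`csingularChainComplex.compIso`.

Universes: `X : Type u`, `K L : Type v` (the two coefficient fields in one universe, as for
`ℚ`, `ℝ`, `ℂ : Type`).

Mathlib (pinned) has no singular homology with coefficients beyond
`AlgebraicTopology.singularHomologyFunctor` and no universal coefficient theorem (searched:
`singularHomology`, `baseChange` + `homology`, `universal coefficient`); used from Mathlib:
`Module.Basis.ofVectorSpace`, `Finsupp.mapRange.linearMap`, `HomologicalComplex.exactAt_iff'`,
`HomologicalComplex.exactAt_iff_isZero_homology`, `ShortComplex.moduleCat_exact_iff`.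

## References

* A. Hatcher, *Algebraic Topology*, CUP 2002, §3.A (universal coefficients for homology,
  Lemma 3A.1, Cor. 3A.4, Prop. 3A.5), §2.2 (homology with coefficients). [HatcherAT2002]
-/

noncomputable section

open CategoryTheory Limits

universe u v

namespace Literature.AlgebraicTopology.SingularHomology

variable {X : Type u} [TopologicalSpace X]

/-! ### The boundary commutes with `K`-linear changes of coefficients -/

section Boundary

variable (K : Type v) {L : Type v} [CommRing K] [CommRing L] [Algebra K L]

/-- On `L`-valued chains the boundary of the `L`-linear concrete complex is the boundary of the
`K`-linear one (both are `∑ᵢ (-1)ⁱ σ ∘ δᵢ`, the signs `(-1)ⁱ ∈ L` being the images of the signs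
in `K`; Hatcher 2002, §2.2, homology with coefficients: "the boundary maps are given by the
same formula"). [cite: HatcherAT2002, §2.2] -/
theorem csingularChainComplex.bd_eq_bd_of_algebra {n : ℕ} (c : CChain L X (n + 1)) :
    csingularChainComplex.bd L n c = csingularChainComplex.bd (M := L) K n c := by
  simp only [csingularChainComplex.bd, LinearMap.sum_apply, LinearMap.smul_apply,
    Finsupp.lmapDomain_apply]
  refine Finset.sum_congr rfl fun i _ ↦ ?_
  rw [← algebraMap_smul L ((-1 : K) ^ (i : ℕ)) (Finsupp.mapDomain (SingularSimplex.face i) c),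
    map_pow, map_neg, map_one]

variable {K}

/-- The boundary has integer coefficients, so a `K`-linear change of coefficients `g : V → W`
applied coefficientwise commutes with it: `g_* (∂ c) = ∂ (g_* c)` (Hatcher 2002, §2.2: a
homomorphism of coefficient groups induces a chain map). [cite: HatcherAT2002, §2.2] -/
theorem csingularChainComplex.mapRange_bd {V W : Type v} [AddCommGroup V] [Module K V]
    [AddCommGroup W] [Module K W] (g : V →ₗ[K] W) {n : ℕ} (c : CChain V X (n + 1)) :
    Finsupp.mapRange.linearMap g (csingularChainComplex.bd (M := V) K n c) =
      csingularChainComplex.bd (M := W) K n (Finsupp.mapRange.linearMap g c) := by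
  simp only [csingularChainComplex.bd, LinearMap.sum_apply, LinearMap.smul_apply, map_sum,
    map_smul, Finsupp.lmapDomain_apply, Finsupp.mapRange.linearMap_apply]
  refine Finset.sum_congr rfl fun i _ ↦ ?_
  rw [Finsupp.mapDomain_mapRange _ _ _ _ (map_add g)]

end Boundary

/-! ### Coordinates of an `L`-chain along a `K`-basis of `L` -/

section Coordinates

variable {K L : Type v} [Field K] [Field L] [Algebra K L]

/-- **Reconstruction of an `L`-chain from its coordinate chains.** For a `K`-basis `b` of `L`
and a finite set `J` of indices containing the coordinate supports of all coefficients of the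
chain `w ∈ Cₙ(X; L)`, `w = ∑_{i ∈ J} bᵢ • ((b.coord i)_* w ⊗ 1)`, where `(b.coord i)_* w ∈ Cₙ(X; K)`
is the `i`-th coordinate chain and `- ⊗ 1` the change of coefficients along `K → L`
(coefficientwise this is `x = ∑ᵢ (b.repr x)ᵢ • bᵢ`; Hatcher 2002, §3.A, `Cₙ(X; G) = Cₙ(X) ⊗ G`).
[cite: HatcherAT2002, §3.A] -/
theorem CChain.sum_smul_mapRange_coord_eq {ι : Type*} (b : Module.Basis ι K L) {n : ℕ}
    (w : CChain L X n) (J : Finset ι) (hJ : ∀ σ ∈ w.support, (b.repr (w σ)).support ⊆ J) :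
    ∑ i ∈ J, b i • Finsupp.mapRange.linearMap (Algebra.linearMap K L)
        (Finsupp.mapRange.linearMap (b.coord i) w) = w := by
  ext σ
  simp only [Finsupp.coe_finsetSum, Finset.sum_apply, Finsupp.smul_apply,
    Finsupp.mapRange.linearMap_apply, Finsupp.mapRange_apply, Algebra.linearMap_apply,
    Module.Basis.coord_apply, smul_eq_mul]
  have key : ∀ x : L, (b.repr x).support ⊆ J → ∑ i ∈ J, b i * algebraMap K L (b.repr x i) = x := by
    intro x hx
    calc ∑ i ∈ J, b i * algebraMap K L (b.repr x i)
        = ∑ i ∈ J, (b.repr x i) • b i :=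
          Finset.sum_congr rfl fun i _ ↦ by rw [Algebra.smul_def, mul_comm]
      _ = Finsupp.linearCombination K b (b.repr x) := by
          rw [Finsupp.linearCombination_apply]
          exact (Finsupp.sum_of_support_subset _ hx (fun i a ↦ a • b i)
            fun i _ ↦ zero_smul K (b i)).symm
      _ = x := b.linearCombination_repr x
  by_cases hσ : σ ∈ w.support
  · exact key (w σ) (hJ σ hσ)
  · rw [Finsupp.notMem_support_iff.1 hσ]
    simp

/-- **Boundaries ascend along `K → L`.** If every coordinate chain `(b.coord i)_* w ∈ Cₙ(X; K)`
of `w ∈ Cₙ(X; L)` is a boundary, `(b.coord i)_* w = ∂ yᵢ`, then `w` is a boundary: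
`w = ∂ (∑_{i ∈ J} bᵢ • (yᵢ ⊗ 1))` for the finite set `J` of relevant coordinates
(`CChain.sum_smul_mapRange_coord_eq`, `csingularChainComplex.mapRange_bd`,
`csingularChainComplex.bd_eq_bd_of_algebra`; Hatcher 2002, §3.A). [cite: HatcherAT2002, §3.A] -/
theorem CChain.exists_bd_eq_of_forall_coord {ι : Type*} (b : Module.Basis ι K L) {n : ℕ}
    (w : CChain L X n)
    (h : ∀ i, ∃ y : CChain K X (n + 1),
      csingularChainComplex.bd (M := K) K n y = Finsupp.mapRange.linearMap (b.coord i) w) :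
    ∃ y : CChain L X (n + 1), csingularChainComplex.bd L n y = w := by
  classical
  choose y hy using h
  refine ⟨∑ i ∈ w.support.biUnion fun σ ↦ (b.repr (w σ)).support,
    b i • Finsupp.mapRange.linearMap (Algebra.linearMap K L) (y i), ?_⟩
  rw [map_sum]
  conv_rhs => rw [← CChain.sum_smul_mapRange_coord_eq b w
    (w.support.biUnion fun σ ↦ (b.repr (w σ)).support)
    (fun σ hσ ↦ Finset.subset_biUnion_of_mem (fun σ ↦ (b.repr (w σ)).support) hσ)]
  refine Finset.sum_congr rfl fun i _ ↦ ?_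
  rw [map_smul, csingularChainComplex.bd_eq_bd_of_algebra K, ← csingularChainComplex.mapRange_bd,
    hy i]

end Coordinates

/-! ### Vanishing ascends -/

section Vanishing

variable (K : Type v) {L : Type v} [Field K] [Field L] [Algebra K L]

/-- Exactness of the concrete complex ascends along a field extension: if every `n`-cycle of
`C_•(X; K)` bounds then so does every `n`-cycle of `C_•(X; L)` — the coordinate chains of an
`L`-cycle are `K`-cycles (`csingularChainComplex.mapRange_bd`), and boundaries ascend
(`CChain.exists_bd_eq_of_forall_coord`). Hatcher 2002, §3.A (Cor. 3A.4 over a field).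
[cite: HatcherAT2002, §3.A] -/
theorem csingularChainComplex.exactAt_of_exactAt_of_algebra (n : ℕ)
    (hK : (csingularChainComplex K K X).ExactAt n) :
    (csingularChainComplex L L X).ExactAt n := by
  let b := Module.Basis.ofVectorSpace K L
  cases n with
  | zero =>
    rw [HomologicalComplex.exactAt_iff' _ 1 0 0 (by simp) (by simp),
      ShortComplex.moduleCat_exact_iff] at hK ⊢
    intro w _
    suffices h : ∃ y : CChain L X 1, csingularChainComplex.bd L 0 y = w by
      obtain ⟨y, hy⟩ := h
      exact ⟨y, by rw [← csingularChainComplex.d_apply] at hy; exact hy⟩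
    refine CChain.exists_bd_eq_of_forall_coord b w fun i ↦ ?_
    obtain ⟨y, hy⟩ := hK (Finsupp.mapRange.linearMap (b.coord i) w) (by
      change ((csingularChainComplex K K X).d 0 0) _ = 0
      rw [HomologicalComplex.shape _ _ _ (by simp [ComplexShape.down_Rel])]
      rfl)
    exact ⟨y, by rw [← csingularChainComplex.d_apply]; exact hy⟩
  | succ m =>
    rw [HomologicalComplex.exactAt_iff' _ (m + 2) (m + 1) m (by simp) (by simp),
      ShortComplex.moduleCat_exact_iff] at hK ⊢
    intro w hw
    replace hw : csingularChainComplex.bd L m w = 0 := by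
      rw [← csingularChainComplex.d_apply]; exact hw
    suffices h : ∃ y : CChain L X (m + 2), csingularChainComplex.bd L (m + 1) y = w by
      obtain ⟨y, hy⟩ := h
      exact ⟨y, by rw [← csingularChainComplex.d_apply] at hy; exact hy⟩
    refine CChain.exists_bd_eq_of_forall_coord b w fun i ↦ ?_
    have hcyc : csingularChainComplex.bd (M := K) K m (Finsupp.mapRange.linearMap (b.coord i) w)
        = 0 := by
      rw [← csingularChainComplex.mapRange_bd, ← csingularChainComplex.bd_eq_bd_of_algebra K, hw,
        map_zero]
    obtain ⟨y, hy⟩ := hK (Finsupp.mapRange.linearMap (b.coord i) w) (by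
      change ((csingularChainComplex K K X).d (m + 1) m) _ = 0
      rw [csingularChainComplex.d_apply]; exact hcyc)
    exact ⟨y, by rw [← csingularChainComplex.d_apply]; exact hy⟩

/-- **`Hₙ(X; K) = 0 ⇒ Hₙ(X; L) = 0` for a field extension `L ⊇ K`** (Hatcher 2002, §3.A,
Cor. 3A.4: `Hₙ(X; L) ≅ Hₙ(X; K) ⊗_K L` as `Tor` vanishes over a field; here only the vanishing
statement, proved by the coordinate argument of this file and transported along the comparison
`csingularChainComplex.compIso` with Mathlib's singular chains). [cite: HatcherAT2002, §3.A Cor. 3A.4] -/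
theorem isZero_singularHomology_of_isZero_of_algebra (n : ℕ)
    (h : IsZero (singularHomology K K X n)) : IsZero (singularHomology L L X n) := by
  have hK : (csingularChainComplex K K X).ExactAt n :=
    ((HomologicalComplex.exactAt_iff_isZero_homology _ n).2 h).of_iso
      (csingularChainComplex.compIso K K X).symm
  exact (HomologicalComplex.exactAt_iff_isZero_homology _ n).1
    ((csingularChainComplex.exactAt_of_exactAt_of_algebra K n hK).of_iso
      (csingularChainComplex.compIso L L X))

/-- **A non-zero homology class over `L` forces one over `K`**: if `Hₙ(X; L)` is non-trivial then
so is `Hₙ(X; K)`, for a field extension `L ⊇ K` (contrapositive of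
`isZero_singularHomology_of_isZero_of_algebra`; Hatcher 2002, §3.A, Cor. 3A.4).
[cite: HatcherAT2002, §3.A Cor. 3A.4] -/
theorem nontrivial_singularHomology_of_algebra (n : ℕ) [Nontrivial (singularHomology L L X n)] :
    Nontrivial (singularHomology K K X n) := by
  by_contra hK
  rw [not_nontrivial_iff_subsingleton] at hK
  haveI := ModuleCat.subsingleton_of_isZero (isZero_singularHomology_of_isZero_of_algebra K n
    (ModuleCat.isZero_of_subsingleton (singularHomology K K X n)) (L := L))
  exact false_of_nontrivial_of_subsingleton (singularHomology L L X n)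

/-- **Betti numbers over `K` detect cohomology over `L`.** If `Hₙ(X; K)` is finite-dimensional and
some class `a ∈ Hⁿ(X; L)` is non-zero, for a field extension `L ⊇ K`, then `1 ≤ bₙ(X; K)`:
by universal coefficients over the field `L` (`kroneckerPairing_injective_of_field`, Hatcher 2002,
§3.1, Thm. 3.2) `⟨a, z⟩ ≠ 0` for some `z ∈ Hₙ(X; L)`, so `Hₙ(X; L) ≠ 0`, so `Hₙ(X; K) ≠ 0`
(`nontrivial_singularHomology_of_algebra`, Hatcher 2002, §3.A, Cor. 3A.4), whose dimension is
then positive. [cite: HatcherAT2002, §3.A Cor. 3A.4 with §3.1 Thm. 3.2] -/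
theorem one_le_bettiNumber_of_ne_zero_of_algebra (n : ℕ)
    [Module.Finite K (singularHomology K K X n)] {a : singularCohomology L L X n} (ha : a ≠ 0) :
    1 ≤ bettiNumber K X n := by
  have hφ : kroneckerPairing L L X n a ≠ 0 := fun h0 ↦
    ha (kroneckerPairing_injective_of_field L X n (h0.trans (map_zero _).symm))
  obtain ⟨z, hz⟩ : ∃ z, kroneckerPairing L L X n a z ≠ 0 := by
    by_contra! h0
    exact hφ (LinearMap.ext h0)
  have hz0 : z ≠ 0 := by
    rintro rfl
    exact hz (map_zero _)
  haveI : Nontrivial (singularHomology L L X n) := nontrivial_of_ne z 0 hz0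
  haveI := nontrivial_singularHomology_of_algebra (X := X) K (L := L) n
  exact Module.finrank_pos

end Vanishing

end Literature.AlgebraicTopology.SingularHomology
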